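import Summits.QuantumFields.YangMills.Theorems.BalabanLadderUVSeamRecPolymerCarrier
import Summits.QuantumFields.YangMills.Theorems.BalabanLadderUVSeamRecPolymerDataLevelZero
import Summits.QuantumFields.YangMills.Theorems.BalabanLadderUVSeamRecCeilingsPolymerRarityPlaquetteScale
import Literature.MathematicalPhysics.QuantumLattice.RepLieAlgebraUnitary
import HarnessLib

/-!
# Crux `UVSeamRec` (stmt-QuantumFields-20043), v5(α) stub `stub_responseMomentsOdd6` (RM): the POLYMER DATA of the tempered
# architecture, IV — FOLDING the level-`0` polymer system of the shells onto an odd torus: box representatives, period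
# translations, one polymer per fibre, and the Λ-budget `Σ_i c_{iq} ≤ 1` of the folded system

Helper file (`--supports stmt-QuantumFields-20043 --as helper`) of the unit `ym-20043-tempered-d1` (gen 1); sequel of
`…PolymerCarrier.lean` (uniform bounds on the influence functional, glue `responseMoments_of_quadratic_and_influence`) and of g0's
`…PolymerDataLevelZero.lean` (p534572: at level `0` the chart returns the plain plaquette, `torusLift_mem_largeFieldEvent_zero_iff`).
Consumed by the sibling `…PolymerCarrierLevelZero.lean`, which proves hypothesis (EM_I) of the (β) architecture at level cutoff `0` on
every odd torus from ceilings-p2's plaquette-scale Peierls gas (p530009).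

WHY FOLDING.  D1's polymers are block plaquettes of `ℤ⁴`; the product law (PL) that ceilings-p2's press-buttons consume
(p527372/p528131/p535725 §2) is asked for ALL sub-families of ONE repetition-free polymer system per torus `(ℤ/(2L+1))⁴`.  Read through the
periodic lift, two level-`0` polymers with block indices congruent modulo `2L+1` define the SAME torus event, and the shells of two cubes
that are close across the period do contain such pairs; so the polymer index on the torus must be the plaquette CLASS — here: its
representative based in the fundamental box `[−L, L]⁴` (coordinatewise `valMinAbs`) — with the shell coefficients summed over the fibres of
the folding.  This file supplies the combinatorics of that folding: §1 representatives (`abs_valMinAbs_le`, `dvd_sub_valMinAbs`,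
`valMinAbs_mem_box`, `proj_valMinAbs`), level-`0` translation covariance of shell and coefficient (`mem_shell_zero_translate_iff`,
`influenceCoeff_zero_translate`), ONE POLYMER PER FIBRE AND SHELL (`eq_of_mem_shell_zero_of_fold_eq`: indices within `2R+2` of one centre
differ by `≤ 4R+4 < 2L+1`); §2 **`sum_foldCoeff_zero_le_one`** — clause (ii) of (PL) for the folded system with `Λ = 1`: translating each
cube by the period vector that moves its fibre polymer onto the representative keeps the family cyclically separated and reduces the claim
to g0's `sum_familyCoeff_le_one` (pigeonhole on the `16` orthants); §3 the lifted level-`0` event in ceilings-p2's cost currency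
(`torusLift_mem_largeFieldEvent_zero_iff_cost`: `N·e ≤ N − Re tr U(∂p)`, `reTr = Re tr/N`).  HONEST FRAMING: bookkeeping (periodisation,
pigeonhole) for the level-`0` large-field half of the (β) discharge architecture of the OPEN stub (RM); levels `k ≥ 1` do NOT fold this
way on general odd sides (`b^k ∤ 2L+1`: the located remark of `…PolymerCarrier.lean`); nothing of E0′; not a gap, not Clay.

References: folklore.
-/

set_option autoImplicit false

noncomputable section

open MeasureTheory Filter Topology Finset
open Literature.Probability.LatticeModels (box mem_box Torus.proj)
open Literature.MathematicalPhysics.QuantumFieldTheory (GaugeConfig LatticeRep plaquetteCost plaquetteHolonomy)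
open Literature.MathematicalPhysics.QuantumFieldTheory.Balaban1983to89 (reTr)
open Literature.MathematicalPhysics.QuantumLattice (LGConfig torusLift ZdPlaquette plaquetteObs fundamentalLatticeRep)

namespace Summit.QuantumFields.YangMills.Cruxes.UVSeamRec.PolymerData

/-! ## §1 Folding block indices into the fundamental box of the odd torus; level-`0` translations -/

section Folding

/-- The symmetric representative of `m mod (2L+1)` lies in `[−L, L]`. [folklore] -/
theorem abs_valMinAbs_le (L : ℕ) (m : ℤ) : |(((m : ZMod (2 * L + 1))).valMinAbs : ℤ)| ≤ L := by
  have h := ZMod.natAbs_valMinAbs_le (n := 2 * L + 1) (m : ZMod (2 * L + 1))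
  have hL : (2 * L + 1) / 2 = L := by omega
  rw [hL] at h
  rw [Int.abs_eq_natAbs]
  exact_mod_cast h

/-- The period divides `m − (symmetric representative of m)`. [folklore] -/
theorem dvd_sub_valMinAbs (L : ℕ) (m : ℤ) :
    ((2 * L + 1 : ℕ) : ℤ) ∣ m - (((m : ZMod (2 * L + 1))).valMinAbs : ℤ) := by
  have h : (((((m : ZMod (2 * L + 1))).valMinAbs : ℤ) : ZMod (2 * L + 1))) = (m : ZMod (2 * L + 1)) :=
    ZMod.coe_valMinAbs _
  exact (ZMod.intCast_eq_intCast_iff_dvd_sub _ _ _).1 h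

/-- The symmetric representatives of the coordinates of `y` form a site of the fundamental box `[−L, L]⁴`. [folklore] -/
theorem valMinAbs_mem_box (L : ℕ) (y : Fin 4 → ℤ) :
    (fun j => ((((y j : ℤ) : ZMod (2 * L + 1))).valMinAbs : ℤ)) ∈ box 4 L := by
  rw [mem_box]
  intro j
  exact abs_le.1 (abs_valMinAbs_le L (y j))

/-- … and project to the same torus site as `y`. [folklore] -/
theorem proj_valMinAbs (L : ℕ) (y : Fin 4 → ℤ) :
    Torus.proj (2 * L + 1) (fun j => ((((y j : ℤ) : ZMod (2 * L + 1))).valMinAbs : ℤ)) = Torus.proj (2 * L + 1) y := by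
  funext j
  simp only [Literature.Probability.LatticeModels.Torus.proj_apply]
  exact ZMod.coe_valMinAbs _

/-- At level `0` the anchor of a polymer is its block index. -/
theorem anchor_zero (𝔟 : BlockSize) (y : Fin 4 → ℤ) (μ ν : Fin 4) (h : μ < ν) : anchor 𝔟 ⟨0, y, μ, ν, h⟩ = y := by
  funext i
  simp [anchor]

/-- Sup-distances are invariant under simultaneous translation. [folklore] -/
theorem supDist_add_right (x z v : Fin 4 → ℤ) : supDist (x + v) (z + v) = supDist x z := by
  unfold supDist
  congr 1
  funext i
  simp only [Pi.add_apply]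
  congr 1
  ring

/-- **Level-`0` translation covariance of the shell**: translating centre and block index by the same vector preserves shell
membership … -/
theorem mem_shell_zero_translate_iff (𝔟 : BlockSize) (R : ℕ) (x v y : Fin 4 → ℤ) (μ ν : Fin 4) (h : μ < ν) :
    (⟨0, y + v, μ, ν, h⟩ : Polymer) ∈ shell 𝔟 0 R (x + v) ↔ (⟨0, y, μ, ν, h⟩ : Polymer) ∈ shell 𝔟 0 R x := by
  rw [mem_shell_iff, mem_shell_iff, anchor_zero, anchor_zero, supDist_add_right]

/-- … and the influence coefficient. -/
theorem influenceCoeff_zero_translate (𝔟 : BlockSize) (x v y : Fin 4 → ℤ) (μ ν : Fin 4) (h : μ < ν) :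
    influenceCoeff 𝔟 ⟨0, y + v, μ, ν, h⟩ (x + v) = influenceCoeff 𝔟 ⟨0, y, μ, ν, h⟩ x := by
  unfold influenceCoeff
  rw [anchor_zero, anchor_zero, supDist_add_right]

/-- **One polymer per fibre and shell**: two polymers of ONE level-`0` shell whose block indices agree modulo `2L+1` coordinatewise and
whose orientations agree are equal, as soon as `4R + 4 < 2L + 1` (both indices lie within sup-distance `2R+2` of the centre). [folklore] -/
theorem eq_of_mem_shell_zero_of_fold_eq (𝔟 : BlockSize) {R L : ℕ} (hRL : 4 * R + 8 ≤ L) {x : Fin 4 → ℤ} {γ γ' : Polymer}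
    (hγ : γ ∈ shell 𝔟 0 R x) (hγ' : γ' ∈ shell 𝔟 0 R x)
    (hy : ∀ j, ((γ.y j : ℤ) : ZMod (2 * L + 1)) = ((γ'.y j : ℤ) : ZMod (2 * L + 1)))
    (hμ : γ.μ = γ'.μ) (hν : γ.ν = γ'.ν) : γ = γ' := by
  obtain ⟨k, y, μ, ν, h⟩ := γ
  obtain ⟨k', y', μ', ν', h'⟩ := γ'
  have hk : k = 0 := Nat.le_zero.1 (level_le_of_mem_shell hγ)
  have hk' : k' = 0 := Nat.le_zero.1 (level_le_of_mem_shell hγ')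
  subst hk hk'
  simp only at hμ hν
  subst hμ hν
  have hyy : y = y' := by
    funext j
    have h1 := natAbs_sub_le_supDist x (anchor 𝔟 ⟨0, y, μ, ν, h⟩) j
    have h2 := natAbs_sub_le_supDist x (anchor 𝔟 ⟨0, y', μ, ν, h'⟩) j
    rw [anchor_zero] at h1 h2
    have d1 := supDist_le_of_mem_shell hγ
    have d2 := supDist_le_of_mem_shell hγ'
    rw [anchor_zero] at d1 d2
    have e1 : ((x j - y j).natAbs : ℤ) ≤ ((2 * R + 2 : ℕ) : ℤ) := by exact_mod_cast h1.trans d1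
    have e2 : ((x j - y' j).natAbs : ℤ) ≤ ((2 * R + 2 : ℕ) : ℤ) := by exact_mod_cast h2.trans d2
    rw [Int.natCast_natAbs] at e1 e2
    push_cast at e1 e2
    have hdvd : ((2 * L + 1 : ℕ) : ℤ) ∣ y' j - y j := (ZMod.intCast_eq_intCast_iff_dvd_sub _ _ _).1 (hy j)
    have hlt : |y' j - y j| < ((2 * L + 1 : ℕ) : ℤ) := by
      have ha := abs_le.1 e1
      have hb := abs_le.1 e2
      push_cast
      rw [abs_lt]; constructor <;> linarith
    have h0 := Int.eq_zero_of_abs_lt_dvd hdvd hlt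
    linarith
  subst hyy
  rfl

end Folding

/-! ## §2 The Λ-budget of the folded level-`0` system: one torus plaquette influences separated cubes with total coefficient `≤ 1` -/

section Budget

/-- **Clause (ii) of (PL) for the FOLDED level-`0` system.**  For a cube family `x` pairwise cyclically `2R+4`-separated on the torus of
side `2L+1` (`4R+8 ≤ L`) and a plaquette `q` of `ℤ⁴`, the shell coefficients of all polymers of all cubes that fold onto `q` (block index
`≡ q.1 (mod 2L+1)` coordinatewise, orientation `q.2`) sum to at most `1`.  Proof: each shell has at most one such polymer
(`eq_of_mem_shell_zero_of_fold_eq`); translating each cube by the period vector that moves its polymer onto `q` keeps the family cyclically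
separated and turns the sum into g0's `Σ_i familyCoeff … ≤ 1` (`sum_familyCoeff_le_one`, pigeonhole on `16` orthants). [folklore] -/
theorem sum_foldCoeff_zero_le_one (𝔟 : BlockSize) {n L R : ℕ} (hRL : 4 * R + 8 ≤ L) (x : Fin n → (Fin 4 → ℤ))
    (hsep : ∀ i j : Fin n, i ≠ j → ∃ k : Fin 4,
      (2 * (R : ℤ) + 4) ≤ |((((x i k - x j k : ℤ) : ZMod (2 * L + 1))).valMinAbs : ℤ)|)
    (q : ZdPlaquette 4) :
    ∑ i, ∑ γ ∈ (shell 𝔟 0 R (x i)).filter (fun γ =>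
        ((fun j => ((((γ.y j : ℤ) : ZMod (2 * L + 1))).valMinAbs : ℤ)), (⟨(γ.μ, γ.ν), γ.hμν⟩ : {p : Fin 4 × Fin 4 // p.1 < p.2})) = q),
      influenceCoeff 𝔟 γ (x i) ≤ 1 := by
  classical
  obtain ⟨s, ⟨⟨μq, νq⟩, hμνq⟩⟩ := q
  -- the fibres
  set fib : Fin n → Finset Polymer := fun i => (shell 𝔟 0 R (x i)).filter (fun γ =>
    ((fun j => ((((γ.y j : ℤ) : ZMod (2 * L + 1))).valMinAbs : ℤ)), (⟨(γ.μ, γ.ν), γ.hμν⟩ : {p : Fin 4 × Fin 4 // p.1 < p.2})) =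
      ((s, ⟨(μq, νq), hμνq⟩) : ZdPlaquette 4))
    with hfib
  -- a fibre is a subsingleton
  have hsub : ∀ i, ∀ γ ∈ fib i, ∀ γ' ∈ fib i, γ = γ' := by
    intro i γ hγ γ' hγ'
    rw [hfib, Finset.mem_filter] at hγ hγ'
    have hq := hγ.2.trans hγ'.2.symm
    simp only [Prod.mk.injEq, Subtype.mk.injEq] at hq
    refine eq_of_mem_shell_zero_of_fold_eq 𝔟 hRL hγ.1 hγ'.1 (fun j => ?_) hq.2.1 hq.2.2
    have hj : ((((γ.y j : ℤ) : ZMod (2 * L + 1))).valMinAbs : ℤ) = (((γ'.y j : ℤ) : ZMod (2 * L + 1))).valMinAbs :=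
      congr_fun hq.1 j
    have hj' := congr_arg (fun z : ℤ => (z : ZMod (2 * L + 1))) hj
    simpa only [ZMod.coe_valMinAbs] using hj'
  -- the translated centres
  set xt : Fin n → (Fin 4 → ℤ) := fun i =>
    if h : (fib i).Nonempty then x i - (h.choose.y - s) else x i with hxt
  -- the reference polymer
  set γq : Polymer := ⟨0, s, μq, νq, hμνq⟩ with hγq
  -- each fibre sum is the family coefficient of `γq` for the translated centre
  have hfibsum : ∀ i, ∑ γ ∈ fib i, influenceCoeff 𝔟 γ (x i) ≤ familyCoeff 𝔟 0 R xt i γq := by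
    intro i
    by_cases hne : (fib i).Nonempty
    · -- the fibre is `{γ_i}`
      set γi := hne.choose with hγi
      have hγimem : γi ∈ fib i := hne.choose_spec
      have hfi : fib i = {γi} := Finset.eq_singleton_iff_unique_mem.2 ⟨hγimem, fun γ hγ => hsub i γ hγ γi hγimem⟩
      rw [hfi, Finset.sum_singleton]
      have hxti : xt i = x i - (γi.y - s) := by
        rw [hxt, hγi]; simp only [dif_pos hne]
      have hmem := hγimem
      rw [hfib, Finset.mem_filter] at hmem
      obtain ⟨hshell, hfold⟩ := hmem
      clear_value γi
      obtain ⟨k, y, μ, ν, h⟩ := γi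
      have hk : k = 0 := Nat.le_zero.1 (level_le_of_mem_shell hshell)
      subst hk
      have hfold2 : ((μ, ν) : Fin 4 × Fin 4) = (μq, νq) := congr_arg Subtype.val (congr_arg Prod.snd hfold)
      obtain ⟨rfl, rfl⟩ := Prod.mk.inj hfold2
      -- translate by the period vector `s - y`
      have e1 : (⟨0, s, μ, ν, hμνq⟩ : Polymer) = ⟨0, y + (s - y), μ, ν, h⟩ := by
        have : y + (s - y) = s := by abel
        rw [this]
      have e2 : x i - (y - s) = x i + (s - y) := by abel
      have hmem' : γq ∈ shell 𝔟 0 R (xt i) := by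
        rw [hγq, hxti, e1, e2, mem_shell_zero_translate_iff]
        exact hshell
      rw [familyCoeff, if_pos hmem', hγq, hxti, e1, e2, influenceCoeff_zero_translate]
    · rw [Finset.not_nonempty_iff_eq_empty.1 hne, Finset.sum_empty]
      exact familyCoeff_nonneg 𝔟 0 R xt i γq
  -- the translated family is cyclically separated (each centre moved by a period vector)
  have hper : ∀ i (k : Fin 4), ((xt i k : ℤ) : ZMod (2 * L + 1)) = ((x i k : ℤ) : ZMod (2 * L + 1)) := by
    intro i k
    by_cases hne : (fib i).Nonempty
    · set γi := hne.choose with hγi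
      have hmem : γi ∈ fib i := hne.choose_spec
      have hxti : xt i = x i - (γi.y - s) := by
        rw [hxt, hγi]; simp only [dif_pos hne]
      rw [hfib, Finset.mem_filter] at hmem
      have hq1 : ((((γi.y k : ℤ) : ZMod (2 * L + 1))).valMinAbs : ℤ) = s k :=
        congr_fun (congr_arg Prod.fst hmem.2) k
      have hdvd := dvd_sub_valMinAbs L (γi.y k)
      rw [hq1] at hdvd
      rw [hxti, Pi.sub_apply, Pi.sub_apply, ZMod.intCast_eq_intCast_iff_dvd_sub]
      have : x i k - (x i k - (γi.y k - s k)) = γi.y k - s k := by ring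
      rw [this]
      exact hdvd
    · rw [hxt]
      simp only [dif_neg hne]
  have hsep' : ∀ i j : Fin n, i ≠ j → ∃ k : Fin 4,
      (2 * (R : ℤ) + 4) ≤ |((((xt i k - xt j k : ℤ) : ZMod (2 * L + 1))).valMinAbs : ℤ)| := by
    intro i j hij
    obtain ⟨k, hk⟩ := hsep i j hij
    refine ⟨k, ?_⟩
    have hcast : (((xt i k - xt j k : ℤ) : ZMod (2 * L + 1))) = (((x i k - x j k : ℤ) : ZMod (2 * L + 1))) := by
      push_cast
      rw [hper i k, hper j k]
    rw [hcast]
    exact hk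
  calc ∑ i, ∑ γ ∈ fib i, influenceCoeff 𝔟 γ (x i) ≤ ∑ i, familyCoeff 𝔟 0 R xt i γq :=
        Finset.sum_le_sum fun i _ => hfibsum i
    _ ≤ 1 := sum_familyCoeff_le_one 𝔟 0 R xt hsep' γq

end Budget

/-! ## §3 The lifted level-`0` event in the cost currency of the plaquette-scale Peierls gas -/

section Cost

variable (N : ℕ) [NeZero N]

/-- **The lifted level-`0` event in ceilings-p2's currency**: `lift U ∈ largeFieldEvent 𝔟 e (0, y, μ<ν)` iff the torus plaquette at
`y mod (2L+1)` has cost `N·e ≤ N − Re tr U(∂p)` in the fundamental representation (`reTr = Re tr / N`, g0's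
`torusLift_mem_largeFieldEvent_zero_iff`). [folklore] -/
theorem torusLift_mem_largeFieldEvent_zero_iff_cost (𝔟 : BlockSize) (e : ℝ) (y : Fin 4 → ℤ) (μ ν : Fin 4) (h : μ < ν)
    (L : ℕ) (U : GaugeConfig 4 (2 * L + 1) (Matrix.specialUnitaryGroup (Fin N) ℂ)) :
    torusLift (2 * L + 1) U ∈ largeFieldEvent (N := N) 𝔟 e ⟨0, y, μ, ν, h⟩ ↔
      (N : ℝ) * e ≤ plaquetteCost (fundamentalLatticeRep N).ρ U (Torus.proj (2 * L + 1) y, ⟨(μ, ν), h⟩) := by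
  rw [torusLift_mem_largeFieldEvent_zero_iff]
  have hN : (0 : ℝ) < N := by exact_mod_cast Nat.pos_of_ne_zero (NeZero.ne N)
  set g := plaquetteHolonomy U (Torus.proj (2 * L + 1) y) μ ν with hg
  have hre : reTr g = ((g : Matrix (Fin N) (Fin N) ℂ).trace.re) / (Fintype.card (Fin N) : ℝ) := rfl
  have hcost : plaquetteCost (fundamentalLatticeRep N).ρ U (Torus.proj (2 * L + 1) y, ⟨(μ, ν), h⟩) =
      (N : ℝ) - (g : Matrix (Fin N) (Fin N) ℂ).trace.re := rfl
  rw [hre, hcost, Fintype.card_fin]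
  constructor
  · intro h1
    have h2 : e * N ≤ (1 - ((g : Matrix (Fin N) (Fin N) ℂ).trace.re) / N) * N := mul_le_mul_of_nonneg_right h1 hN.le
    have h3 : (1 - ((g : Matrix (Fin N) (Fin N) ℂ).trace.re) / N) * N = N - (g : Matrix (Fin N) (Fin N) ℂ).trace.re := by
      field_simp
    nlinarith
  · intro h1
    have h2 : e ≤ ((N : ℝ) - (g : Matrix (Fin N) (Fin N) ℂ).trace.re) / N := by
      rw [le_div_iff₀ hN]; linarith
    rw [sub_div, div_self hN.ne'] at h2
    exact h2

end Cost

end Summit.QuantumFields.YangMills.Cruxes.UVSeamRec.PolymerData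

end
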